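import Summits.AtomisticToContinuum.FouriersLaw.Theses.HonestZwanzig
import Summits.AtomisticToContinuum.FouriersLaw.Theorems.HonestZwanzigNetworkReductionLimits

/-!
# HonestZwanzig / NetworkReduction — the deterministic reduction (closing file)

Closes item `stmt-AtomisticToContinuum-12701` of route `HonestZwanzig` (sub-problem `FouriersLaw`):
`NetworkReduction := GeneratorSiteEnergy → ParityStatics → FeshbachIdentities → OrthogonalOhm →
PositiveMemory → RobinCoercivity → MemoryConductivity`.

Proof (finite-dimensional linear algebra + two limits, no dynamics beyond the route's fixed-`N`
package): at fixed `N ≥ 2` and `0 < s < s₀(N)` the exact circuit formula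
`lap_s(J,J) = Σ_b schur_s(j_b,J) − aᵀG(s)⁻¹a`, `a_x = lap_s(J,e_x)` with
`0 ≤ aᵀG⁻¹a = 2m·ξ − ξᵀ𝔽ξ`, `𝔽_N(s) = Cov(e,e)G(s)⁻¹Cov(e,e)` (from the Kolmogorov identities, time
reversal and the symmetry of `Cov(e_x, L e_y)` of `ParityStatics`), `ξ = Cov(e,e)⁻¹a`,
`m_y = σ_{y−1}(s) − σ_y(s) + γ[y∈∂]τ_y(s)` (`GeneratorSiteEnergy`), whence by Robin coercivity and a
completed-square optimisation
`Σ_bσ_b(s) − c⁻¹(Σ_{b+1<N}(σ_b(s)−k)² + (γτ_0(s)−k)² + (γτ_{N−1}(s)+k)²) ≤ lap_s(J,J) ≤ Σ_bσ_b(s)`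
(support files `…Robin`, `…Circuit`, `…Observables`, `…Bilinear`, `…Package`); `s ↓ 0` by dominated
convergence and the limits of `OrthogonalOhm` (`…Limits`); then `N → ∞`: with `|ρ_b| ≤ C`,
`|ρ_b − k| ≤ ε'` on all but `≤ 2R+1` bonds, `|w| ≤ C`, one gets
`|∫₀^∞corr(J,J) − (N−1)k| ≤ N(ε' + ε'²/c) + K(R)` (`abs_sub_le_of_ohm`), hence
`∫₀^∞corr(J,J)/(N−1) → k`; and `k ≥ k₀/2 > 0` by `PositiveMemory` tested on one deep bulk bond.
The invariance clause (0) of `FeshbachIdentities` and the first clause of `ParityStatics` are not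
needed.
-/

noncomputable section

open MeasureTheory Finset Real Set Filter ProbabilityTheory Topology
open Literature.MathematicalPhysics.KineticTheory.HeatConduction

namespace Summit.AtomisticToContinuum.FouriersLaw.Theorems.HonestZwanzig.NetworkReduction

/-! ### Bounding the fixed-`N` limit by the Ohm-law data -/

/-- **Bookkeeping at fixed `N`.** If `LB ≤ I ≤ UB` with `UB = Σ_b ρ_b`,
`LB = UB − c⁻¹(Σ_{b+1<N}(ρ_b − k)² + (γw₀ − k)² + (γw₁ + k)²)`, `|ρ_b| ≤ C` on bonds, `ρ = 0` past the
last site, `|ρ_b − k| ≤ ε'` on bulk bonds, `|w₀|, |w₁| ≤ C`, then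
`|I − (N−1)k| ≤ N(ε' + ε'²/c) + K` with `K = (2R+1)(C+|k|) + c⁻¹((2R+1)(C+|k|)² + 2(|γ|C+|k|)²)`. -/
theorem abs_sub_le_of_ohm {N : ℕ} (hN : 2 ≤ N) (R : ℕ) {c C k ε' γ' I w₀ w₁ : ℝ} (hc : 0 < c)
    (hC : 0 ≤ C) (hε' : 0 ≤ ε') (ρ : Fin N → ℝ)
    (hρC : ∀ b : Fin N, b.val + 1 < N → |ρ b| ≤ C)
    (hρ0 : ∀ b : Fin N, ¬ b.val + 1 < N → ρ b = 0)
    (hρk : ∀ b : Fin N, b.val + 1 < N → R ≤ b.val → b.val + 2 + R ≤ N → |ρ b - k| ≤ ε')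
    (hw₀ : |w₀| ≤ C) (hw₁ : |w₁| ≤ C)
    (hLB : (∑ b, ρ b) - (1 / c) * ((∑ b : Fin N, if b.val + 1 < N then (ρ b - k) ^ 2 else 0) +
        (γ' * w₀ - k) ^ 2 + (γ' * w₁ + k) ^ 2) ≤ I)
    (hUB : I ≤ ∑ b, ρ b) :
    |I - ((N : ℝ) - 1) * k| ≤ N * (ε' + ε' ^ 2 / c) + ((2 * R + 1) * (C + |k|) +
      (1 / c) * ((2 * R + 1) * (C + |k|) ^ 2 + 2 * (|γ'| * C + |k|) ^ 2)) := by
  have h0 : 0 < N := by omega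
  have hN1 : N - 1 < N := by omega
  -- the deviations from Ohm's law
  set u : Fin N → ℝ := fun b => if b.val + 1 < N then ρ b - k else 0 with hu
  have hsumk : (∑ b : Fin N, if b.val + 1 < N then k else 0) = ((N : ℝ) - 1) * k := by
    have hpt : ∀ b : Fin N, (if b.val + 1 < N then k else 0) = k - (if b.val = N - 1 then k else 0) := by
      intro b
      by_cases hb : b.val + 1 < N
      · rw [if_pos hb, if_neg (by omega)]; ring
      · rw [if_neg hb, if_pos (by omega)]; ring
    simp_rw [hpt]
    rw [Finset.sum_sub_distrib, sum_ite_val_eq (N - 1) hN1 (fun _ => k), Finset.sum_const,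
      Finset.card_univ, Fintype.card_fin, nsmul_eq_mul]
    ring
  have hUB' : (∑ b, ρ b) = ((N : ℝ) - 1) * k + ∑ b, u b := by
    rw [← hsumk, ← Finset.sum_add_distrib]
    refine Finset.sum_congr rfl fun b _ => ?_
    simp only [hu]
    by_cases hb : b.val + 1 < N
    · rw [if_pos hb, if_pos hb]; ring
    · rw [if_neg hb, if_neg hb, hρ0 b hb]; ring
  -- |u_b| ≤ ε' in the bulk, ≤ C + |k| everywhere
  have hM : 0 ≤ C + |k| := by positivity
  have hub : ∀ b : Fin N, R ≤ b.val → b.val + 2 + R ≤ N → |u b| ≤ ε' := by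
    intro b h1 h2
    simp only [hu]
    rw [if_pos (by omega)]
    exact hρk b (by omega) h1 h2
  have hua : ∀ b : Fin N, |u b| ≤ C + |k| := by
    intro b
    simp only [hu]
    by_cases hb : b.val + 1 < N
    · rw [if_pos hb]
      calc |ρ b - k| ≤ |ρ b| + |k| := abs_sub _ _
        _ ≤ C + |k| := by linarith [hρC b hb]
    · rw [if_neg hb, abs_zero]; exact hM
  have hS1 : |∑ b, u b| ≤ N * ε' + (2 * R + 1) * (C + |k|) :=
    (Finset.abs_sum_le_sum_abs _ _).trans (sum_abs_le_of_bulk R u hε' hM hub hua)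
  -- squares
  have hsq : (∑ b : Fin N, if b.val + 1 < N then (ρ b - k) ^ 2 else 0) = ∑ b, |u b ^ 2| := by
    refine Finset.sum_congr rfl fun b _ => ?_
    simp only [hu]
    by_cases hb : b.val + 1 < N
    · rw [if_pos hb, if_pos hb, abs_of_nonneg (sq_nonneg _)]
    · rw [if_neg hb, if_neg hb]; simp
  have hub2 : ∀ b : Fin N, R ≤ b.val → b.val + 2 + R ≤ N → |u b ^ 2| ≤ ε' ^ 2 := by
    intro b h1 h2
    rw [abs_of_nonneg (sq_nonneg _), ← sq_abs]
    exact pow_le_pow_left₀ (abs_nonneg _) (hub b h1 h2) 2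
  have hua2 : ∀ b : Fin N, |u b ^ 2| ≤ (C + |k|) ^ 2 := by
    intro b
    rw [abs_of_nonneg (sq_nonneg _), ← sq_abs]
    exact pow_le_pow_left₀ (abs_nonneg _) (hua b) 2
  have hS2 : (∑ b, |u b ^ 2|) ≤ N * ε' ^ 2 + (2 * R + 1) * (C + |k|) ^ 2 :=
    sum_abs_le_of_bulk R (fun b => u b ^ 2) (sq_nonneg _) (sq_nonneg _) hub2 hua2
  -- contact terms
  have hB : ∀ w : ℝ, |w| ≤ C → ∀ σ : ℝ, (σ = 1 ∨ σ = -1) → (γ' * w - σ * k) ^ 2 ≤ (|γ'| * C + |k|) ^ 2 := by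
    intro w hw σ hσ
    rw [← sq_abs (γ' * w - σ * k)]
    refine pow_le_pow_left₀ (abs_nonneg _) ?_ 2
    have hσk : |σ * k| = |k| := by
      rcases hσ with h | h <;> simp [h]
    calc |γ' * w - σ * k| ≤ |γ' * w| + |σ * k| := abs_sub _ _
      _ = |γ'| * |w| + |k| := by rw [abs_mul, hσk]
      _ ≤ |γ'| * C + |k| := by nlinarith [abs_nonneg γ']
  have hB0 := hB w₀ hw₀ 1 (Or.inl rfl)
  have hB1 := hB w₁ hw₁ (-1) (Or.inr rfl)
  rw [one_mul] at hB0
  rw [neg_one_mul, sub_neg_eq_add] at hB1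
  -- assemble
  rw [hUB', hsq] at hLB
  rw [hUB'] at hUB
  have hc' : 0 ≤ 1 / c := by positivity
  have habs := abs_le.mp hS1
  have hexp : (N : ℝ) * (ε' + ε' ^ 2 / c) = N * ε' + (1 / c) * (N * ε' ^ 2) := by
    field_simp
  have hK2 : 0 ≤ (1 / c) * ((2 * R + 1) * (C + |k|) ^ 2 + 2 * (|γ'| * C + |k|) ^ 2) := by positivity
  have hNe : 0 ≤ (1 / c) * ((N : ℝ) * ε' ^ 2) := by positivity
  rw [abs_le]
  constructor
  · have : (1 / c) * ((∑ b, |u b ^ 2|) + (γ' * w₀ - k) ^ 2 + (γ' * w₁ + k) ^ 2) ≤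
        (1 / c) * ((N * ε' ^ 2 + (2 * R + 1) * (C + |k|) ^ 2) + (|γ'| * C + |k|) ^ 2 +
          (|γ'| * C + |k|) ^ 2) := mul_le_mul_of_nonneg_left (by linarith) hc'
    have hdist : (1 / c) * ((N * ε' ^ 2 + (2 * R + 1) * (C + |k|) ^ 2) + (|γ'| * C + |k|) ^ 2 +
          (|γ'| * C + |k|) ^ 2) = (1 / c) * ((N : ℝ) * ε' ^ 2) +
          (1 / c) * ((2 * R + 1) * (C + |k|) ^ 2 + 2 * (|γ'| * C + |k|) ^ 2) := by ring
    linarith [habs.1]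
  · linarith [habs.2]

/-! ### The reduction -/

/-- **NetworkReduction** (item `stmt-AtomisticToContinuum-12701` of route `HonestZwanzig`): the
deterministic reduction `GeneratorSiteEnergy → ParityStatics → FeshbachIdentities → OrthogonalOhm →
PositiveMemory → RobinCoercivity → MemoryConductivity`. At fixed `N` and small `s > 0` the exact
circuit formula `lap_s(J,J) = Σ_b schur_s(j_b,J) − aᵀG⁻¹a` (`a_x = lap_s(J,e_x)`) holds with
`0 ≤ aᵀG⁻¹a = 2m·ξ − ξᵀ𝔽ξ`, `𝔽 = Cov(e,e)G⁻¹Cov(e,e)`, `m_y = σ_{y−1} − σ_y + γ[y∈∂]τ_y`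
(`fixedN_sandwich`); Robin coercivity and the completed-square optimisation bound the backflow by
`c⁻¹(Σ_b(σ_b − k)² + O(1))`; `s ↓ 0` by dominated convergence (`fixedN_limit`); then `N → ∞` with
the `ε/R` bookkeeping of `OrthogonalOhm` (`abs_sub_le_of_ohm`, `tendsto_div_of_linear_bound`), and
`k ≥ k₀/2 > 0` by `PositiveMemory` on one deep bulk bond. -/
theorem networkReduction_proof :
    Summit.AtomisticToContinuum.FouriersLaw.Theses.HonestZwanzig.NetworkReduction := by
  intro hGSE hPS hFI hOO hPM hRC ω₂ lam β γ hω hl hβ hγ T hT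
  obtain ⟨k, C, hkC⟩ := hOO ω₂ lam β γ hω hl hβ hγ T hT
  obtain ⟨k₀, hk₀, R', hPM'⟩ := hPM ω₂ lam β γ hω hl hβ hγ T hT
  obtain ⟨c, hc, hRCN⟩ := hRC ω₂ lam β γ hω hl hβ hγ T hT
  refine ⟨k, ?_, ?_⟩
  · -- positivity of k: compare with PositiveMemory on one deep bulk bond
    obtain ⟨R, hR⟩ := hkC (k₀ / 2) (half_pos hk₀)
    set M := max R R' with hM
    have hN : 2 ≤ 2 * M + 2 := by omega
    obtain ⟨hbonds, -⟩ := hR (2 * M + 2) hN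
    obtain ⟨ρ, hρ, -, hρk⟩ := hbonds ⟨M, by omega⟩ (by simp; omega)
    have h1 : |ρ - k| ≤ k₀ / 2 := hρk (by simp [hM]) (by simp [hM]; omega)
    have h2 : k₀ ≤ ρ := hPM' (2 * M + 2) hN ⟨M, by omega⟩ (by simp [hM]) (by simp [hM]; omega) ρ hρ
    rw [abs_le] at h1
    linarith
  · refine tendsto_div_of_linear_bound _ k fun ε hε => ?_
    -- Ohm tolerance ε' with 2ε' + 2ε'²/c ≤ ε
    set ε' : ℝ := min (min (ε / 4) 1) (c * ε / 4) with hε'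
    have hε'pos : 0 < ε' := by
      simp only [hε', lt_min_iff]
      exact ⟨⟨by linarith, one_pos⟩, by positivity⟩
    have hε'1 : ε' ≤ ε / 4 := (min_le_left _ _).trans (min_le_left _ _)
    have hε'2 : ε' ≤ 1 := (min_le_left _ _).trans (min_le_right _ _)
    have hε'3 : ε' ≤ c * ε / 4 := min_le_right _ _
    have hε'sum : 2 * (ε' + ε' ^ 2 / c) ≤ ε := by
      have : ε' ^ 2 / c ≤ ε / 4 := by
        rw [div_le_iff₀ hc]
        nlinarith
      linarith
    obtain ⟨R, hR⟩ := hkC ε' hε'pos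
    -- 0 ≤ C (there is at least one bond at N = 2)
    have hC0 : 0 ≤ C := by
      obtain ⟨hb2, -⟩ := hR 2 le_rfl
      obtain ⟨ρ, -, hρC, -⟩ := hb2 ⟨0, by norm_num⟩ (by norm_num)
      exact (abs_nonneg ρ).trans hρC
    refine ⟨(2 * R + 1) * (C + |k|) + (1 / c) * ((2 * R + 1) * (C + |k|) ^ 2 +
      2 * (|γ| * C + |k|) ^ 2), fun N hN => ?_⟩
    -- the fixed-N data
    obtain ⟨-, hFI2, hCp, hGp⟩ := hFI ω₂ lam β γ hω hl hβ hγ T hT N hN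
    obtain ⟨s₀, hs₀, hRob⟩ := hRCN N hN
    obtain ⟨hbonds, hcontacts⟩ := hR N hN
    choose ρf hρf using hbonds
    obtain ⟨w₀, hw₀, hw₀C⟩ := hcontacts ⟨0, by omega⟩ (Or.inl rfl)
    obtain ⟨w₁, hw₁, hw₁C⟩ := hcontacts ⟨N - 1, by omega⟩ (Or.inr rfl)
    set ρ : Fin N → ℝ := fun b => if h : b.val + 1 < N then ρf b h else 0 with hρdef
    have hρt : ∀ b : Fin N, (hb : b.val + 1 < N) → ρ b = ρf b hb := fun b hb => by
      simp only [hρdef, dif_pos hb]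
    have hρ0 : ∀ b : Fin N, ¬ b.val + 1 < N → ρ b = 0 := fun b hb => by
      simp only [hρdef, dif_neg hb]
    have key := fixedN_limit (ω₂ := ω₂) (lam := lam) (β := β) (γ := γ) (N := N) (T := T)
      (fun f => Iff.rfl) (fun f g t => rfl) (fun s f g => rfl) (fun f g => rfl) (fun x z => rfl)
      (fun s x y => rfl) (fun s f g => rfl) (fun s x y => rfl) hFI2
      (fun x z => hGSE ω₂ lam β γ N hN T T x z)
      (fun x y => ((hPS ω₂ lam β γ hω hl hβ hγ T hT N hN) x).2 y)
      hω hl.le hβ.le hγ.le hT hN hCp hGp hc hs₀ hRob ρ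
      (fun b hb => by rw [hρt b hb]; exact (hρf b hb).1) hρ0 w₀ w₁ hw₀ hw₁ k
    have hb := abs_sub_le_of_ohm hN R hc hC0 hε'pos.le ρ
      (fun b hb => by rw [hρt b hb]; exact (hρf b hb).2.1) hρ0
      (fun b hb h1 h2 => by rw [hρt b hb]; exact (hρf b hb).2.2 h1 h2) hw₀C hw₁C key.1 key.2
    have hNR : (N : ℝ) * (ε' + ε' ^ 2 / c) ≤ ((N : ℝ) - 1) * ε := by
      have hN2 : (2 : ℝ) ≤ N := by exact_mod_cast hN
      have hpos : 0 ≤ ε' + ε' ^ 2 / c := by positivity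
      nlinarith
    have hγ' : (pinnedChain ω₂ lam β γ).γ = γ := rfl
    rw [hγ'] at hb
    refine hb.trans ?_
    linarith

end Summit.AtomisticToContinuum.FouriersLaw.Theorems.HonestZwanzig.NetworkReduction
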